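import Summits.Ventures.LatticeQCDFlow.Scaling.DominatedStarRegimeFreeRelaxation
import Literature.Probability.MarkovChains.TimeAverageConcentration

/-!
HONEST FRAMING: exact (Metropolis-corrected) sampling algorithms for lattice gauge theory; figures
of merit are autocorrelation/cost numbers at stated couplings and volumes; no continuum-physics
claim.

# DominatedStarRegimeFreeTimeAverages — HONEST SAMPLE SIZES WITHOUT THE REGIME: FOR THE MAP-ASSISTED HOT-REFRESHED HUB WITH
# ENTRY MAPS, `G = p·min{ct/(3m), (1−t)w_0/(7K)}`, EVERY OBSERVABLE `f` AND ACCURACY `η`: IN EQUILIBRIUM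
# `P_π̃{|N⁻¹Σ_{s<N} f(X_s) − E_π̃ f| ≥ η} ≤ 2Var(f)/(G·N·η²)` (NO LOGARITHM AT ALL), AND FROM EVERY START, AFTER A BURN-IN OF
# `r ≥ ⌈G⁻¹·log(1/(ε·π̃_min))⌉` STEPS, `N ≥ 4Var(f)/(G·η²ε)` SAMPLES GIVE `P_x{|…| ≥ η} ≤ ε` — CHAPTER M'S THEOREM 12.21 CEILING
# (M11) WITH `4t ≤ p(1−t)w_0` REMOVED AND `log((2K+p)/(pε))` REPLACED BY `log(1/(ε π̃_min))` (lean-2 GEN-28, ours)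

Venture-side (OURS).  Cell `lqcd-flow` (pub-lqcd), unit `pub-lqcd-lean-2-g28`, 2026-08-28.  Chapter N, file 8: the `(ε, η)` sample
size of `Scaling/DominatedStarTimeAverages` (M11) in the regime-free theory.  Levin–Peres–Wilmer Theorem 12.21 (in the tree) needs a
burn-in of one mixing time and a run of `4Var/(η²εγ)`; its stationary form needs only the gap.  With N2's gap floor `G` and N4's
mixing ceiling the burn-in carries the volume logarithm `log(1/π̃_min)` — the one place where OPEN-MATH item 1 still costs — while
the RUN LENGTH `4Var(f)/(G·η²ε)` is regime-free and logarithm-free.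

## What is proved

* `dominatedStar_worstTvDist_le_regimeFree` — `d(n) ≤ ε` once `n ≥ G⁻¹·log(1/(2ε·π̃_min))` (any `0 < π̃_min ≤ π̃`).
* **`dominatedStar_timeAverage_stationary_regimeFree`** — in equilibrium, for `N ≥ 1`:
  `Σ_y π̃(y)·P_y{|N⁻¹Σ_{s<N} f(X_s) − E_π̃ f| ≥ η} ≤ 2Var_π̃(f)/(G·N·η²)`.
* **`dominatedStar_timeAverage_regimeFree`** — from every start `x`: `r ≥ ⌈G⁻¹·log(1/(ε·π̃_min))⌉`, `N ≥ 1`,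
  `N ≥ (4Var_π̃(f)/(η²ε))·G⁻¹` ⇒ `P_x{|N⁻¹Σ_{s<N} f(X_{r+s}) − E_π̃ f| ≥ η} ≤ ε`.
All under M11's hypotheses with the regime replaced by `0 < t < 1`, `0 < w_0`, `K ≥ 1`.

Reading (no numerics implied): the number of exact-sampler-hub steps that buys an `η`-accurate estimate of any observable with
confidence `1 − ε` is `4Var(f)/(η²ε)` relaxation-time units `G⁻¹ = (1/p)·max{3m/(ct), 7K/((1−t)w_0)}`, whatever the ratio of swap
fraction to transport quality; only the warm-up from a cold start still pays the configuration-space volume.  NOT CLAIMED: a `log K`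
burn-in outside the regime (item 1); variance-reduced estimators; anything measured.  Literature grade (cell rule): OWN COMPOSITION on
N2/N4 and the tree's Levin–Peres–Wilmer Theorem 12.21 / 12.4; nothing cited as a fact; no new bib keys.
-/

noncomputable section

open Finset Function Matrix
open Literature.Probability.MarkovChains

namespace Summit.Ventures.LatticeQCDFlow.Scaling

variable {S : Type*} [Fintype S] [DecidableEq S] {K m : ℕ} {μ : Fin (K + 1) → S → ℝ} {M : Fin (K + 1) → S → S → ℝ}
  {w : Fin (K + 1) → ℝ} {t p : ℝ}

section Avg
variable (κ : Fin m → Fin K) (φ : Fin m → Equiv.Perm S)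

/-- **`d(n) ≤ ε` once `n ≥ G⁻¹·log(1/(2ε·π̃_min))`**, `G = p·min{ct/(3m), (1−t)w_0/(7K)}` (regime-free; `0 < π̃_min ≤ π̃`). [ours] -/
theorem dominatedStar_worstTvDist_le_regimeFree [Nontrivial S] (hK : 1 ≤ K) (hm : 1 ≤ m) (ht0 : 0 < t) (ht1 : t < 1)
    (hw0 : ∀ k, 0 ≤ w k) (hw00 : 0 < w 0) (hw1 : ∑ k, w k = 1) (hμ : ∀ k x, 0 < μ k x)
    (hμ1 : ∀ k, ∑ u, μ k u = 1) (hM : ∀ k, IsRowStochastic (M k)) (hMrev : ∀ k, DetailedBalance (μ k) (M k))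
    (hM0 : ∀ u v, M 0 u v = μ 0 v) (hp0 : 0 < p) (hp1 : p ≤ 1) (hdom : ∀ r u, p * μ (κ r).succ (φ r u) ≤ μ 0 u)
    {c : ℕ} (hc1 : 1 ≤ c) (hc : ∀ p' : Fin K, c ≤ (univ.filter (fun r : Fin m => κ r = p')).card)
    {πmin : ℝ} (hmin0 : 0 < πmin) (hmin : ∀ x, πmin ≤ tensorFun μ x) {ε : ℝ} (hε : 0 < ε) {n : ℕ}
    (hn : 1 / (p * min (c * t / (3 * m)) ((1 - t) * w 0 / (7 * K))) * Real.log (1 / (2 * ε * πmin)) ≤ n) :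
    worstTvDist (fun y z : Fin (K + 1) → S =>
        t * ptGraphSwap μ (fun r : Fin m => (((0 : Fin (K + 1)), (κ r).succ) : Fin (K + 1) × Fin (K + 1))) φ y z
          + (1 - t) * prodKernel w M y z) (tensorFun μ) n ≤ ε := by
  have hKr : (1 : ℝ) ≤ K := by exact_mod_cast hK
  have hmpos : (0 : ℝ) < m := Nat.cast_pos.mpr (by omega)
  have hcpos : (0 : ℝ) < c := Nat.cast_pos.mpr (by omega)
  have h1t : 0 < 1 - t := by linarith
  set G : ℝ := p * min (c * t / (3 * m)) ((1 - t) * w 0 / (7 * K)) with hG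
  have hGpos : 0 < G := mul_pos hp0 (lt_min (by positivity) (by positivity))
  have hgap := dominatedStar_absSpectralGap_ge_regimeFree κ φ hK hm ht0 ht1 hw0 hw00 hw1 hμ hμ1 hM hMrev hM0 hp0 hp1 hdom hc1 hc
  rw [← hG] at hgap
  have hd := worstTvDist_le_exp (tensorFun_pos hμ) (sum_tensorFun_eq_one μ hμ1)
    (weightedScheme_isRowStochastic (ptGraphSwap_isRowStochastic hμ) hM hw0 hw1 ht0.le ht1.le)
    (weightedScheme_detailedBalance (ptGraphSwap_detailedBalance hμ) hMrev t)
    (dominatedStar_isIrreducible_regimeFree κ φ ht0 ht1 hw0 hw00 hw1 hμ hM hM0 hc1 hc) hmin0 hmin n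
  refine hd.trans ?_
  -- `exp(−γ⋆ n) ≤ exp(−G n) ≤ 2ε π_min`
  have h2 : 0 < 2 * ε * πmin := by positivity
  have hGn : Real.log (1 / (2 * ε * πmin)) ≤ G * n := by
    have h := mul_le_mul_of_nonneg_left hn hGpos.le
    rwa [← mul_assoc, mul_one_div_cancel hGpos.ne', one_mul] at h
  have hexp : Real.exp (-(absSpectralGap (fun y z : Fin (K + 1) → S =>
      t * ptGraphSwap μ (fun r : Fin m => (((0 : Fin (K + 1)), (κ r).succ) : Fin (K + 1) × Fin (K + 1))) φ y z
        + (1 - t) * prodKernel w M y z) * n)) ≤ 2 * ε * πmin := by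
    rw [← Real.exp_log h2]
    apply Real.exp_le_exp.mpr
    have hlog : Real.log (1 / (2 * ε * πmin)) = -Real.log (2 * ε * πmin) := by rw [one_div, Real.log_inv]
    rw [hlog] at hGn
    have hn0 : (0 : ℝ) ≤ n := Nat.cast_nonneg n
    nlinarith [mul_le_mul_of_nonneg_right hgap hn0]
  calc Real.exp (-(absSpectralGap _ * n)) / (2 * πmin) ≤ 2 * ε * πmin / (2 * πmin) :=
        div_le_div_of_nonneg_right hexp (by positivity)
    _ = ε := by field_simp

/-- **HONEST SAMPLE SIZE IN EQUILIBRIUM, NO REGIME, NO LOGARITHM:** for every observable `f`, accuracy `η > 0` and run length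
`N ≥ 1`, `Σ_y π̃(y)·P_y{|N⁻¹Σ_{s<N} f(X_s) − E_π̃ f| ≥ η} ≤ 2Var_π̃(f)/(G·N·η²)` with `G = p·min{ct/(3m), (1−t)w_0/(7K)}`. [ours] -/
theorem dominatedStar_timeAverage_stationary_regimeFree [Nontrivial S] (hK : 1 ≤ K) (hm : 1 ≤ m) (ht0 : 0 < t) (ht1 : t < 1)
    (hw0 : ∀ k, 0 ≤ w k) (hw00 : 0 < w 0) (hw1 : ∑ k, w k = 1) (hμ : ∀ k x, 0 < μ k x)
    (hμ1 : ∀ k, ∑ u, μ k u = 1) (hM : ∀ k, IsRowStochastic (M k)) (hMrev : ∀ k, DetailedBalance (μ k) (M k))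
    (hM0 : ∀ u v, M 0 u v = μ 0 v) (hp0 : 0 < p) (hp1 : p ≤ 1) (hdom : ∀ r u, p * μ (κ r).succ (φ r u) ≤ μ 0 u)
    {c : ℕ} (hc1 : 1 ≤ c) (hc : ∀ p' : Fin K, c ≤ (univ.filter (fun r : Fin m => κ r = p')).card)
    (f : (Fin (K + 1) → S) → ℝ) {η : ℝ} (hη : 0 < η) {N : ℕ} (hN : 0 < N) :
    ∑ y : Fin (K + 1) → S, tensorFun μ y * pathSum (fun y z : Fin (K + 1) → S =>
        t * ptGraphSwap μ (fun r : Fin m => (((0 : Fin (K + 1)), (κ r).succ) : Fin (K + 1) × Fin (K + 1))) φ y z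
          + (1 - t) * prodKernel w M y z) N y (fun ω =>
        if η ≤ |(∑ s, f (ω s)) / N - lawMean (tensorFun μ) f| then (1 : ℝ) else 0)
      ≤ 2 * lawVariance (tensorFun μ) f / (p * min (c * t / (3 * m)) ((1 - t) * w 0 / (7 * K)) * N * η ^ 2) := by
  have hKr : (1 : ℝ) ≤ K := by exact_mod_cast hK
  have hmpos : (0 : ℝ) < m := Nat.cast_pos.mpr (by omega)
  have hcpos : (0 : ℝ) < c := Nat.cast_pos.mpr (by omega)
  have h1t : 0 < 1 - t := by linarith
  have hNpos : (0 : ℝ) < N := by exact_mod_cast hN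
  set G : ℝ := p * min (c * t / (3 * m)) ((1 - t) * w 0 / (7 * K)) with hG
  have hGpos : 0 < G := mul_pos hp0 (lt_min (by positivity) (by positivity))
  have hP := weightedScheme_isRowStochastic (t := t) (w := w)
    (ptGraphSwap_isRowStochastic (e := fun r : Fin m => (((0 : Fin (K + 1)), (κ r).succ) : Fin (K + 1) × Fin (K + 1)))
      (φ := φ) hμ) hM hw0 hw1 ht0.le ht1.le
  have hDB := weightedScheme_detailedBalance (w := w)
    (ptGraphSwap_detailedBalance (e := fun r : Fin m => (((0 : Fin (K + 1)), (κ r).succ) : Fin (K + 1) × Fin (K + 1)))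
      (φ := φ) hμ) hMrev t
  have hirr := dominatedStar_isIrreducible_regimeFree κ φ ht0 ht1 hw0 hw00 hw1 hμ hM hM0 hc1 hc
  have h := LevinPeres2017_thm_12_21_stationary (fun z => tensorFun_pos hμ z) (sum_tensorFun_eq_one _ hμ1) hP hDB hirr f hη hN
  refine h.trans ?_
  have hgap := dominatedStar_spectralGap_ge_regimeFree κ φ hK hm ht0 ht1 hw0 hw00 hw1 hμ hμ1 hM hMrev hM0 hp0 hp1 hdom hc1 hc
  rw [← hG] at hgap
  have hV : 0 ≤ 2 * lawVariance (tensorFun μ) f :=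
    mul_nonneg (by norm_num) (lawVariance_nonneg (fun z => (tensorFun_pos hμ z).le) f)
  exact div_le_div_of_nonneg_left hV (by positivity) (by nlinarith [mul_le_mul_of_nonneg_right hgap (by positivity : (0:ℝ) ≤ N * η ^ 2)])

/-- **HONEST SAMPLE SIZE FROM EVERY START, NO REGIME:** burn-in `r ≥ ⌈G⁻¹·log(1/(ε·π̃_min))⌉`, run `N ≥ 1` with
`N ≥ (4Var_π̃(f)/(η²ε))·G⁻¹`, `G = p·min{ct/(3m), (1−t)w_0/(7K)}`: `P_x{|N⁻¹Σ_{s<N} f(X_{r+s}) − E_π̃ f| ≥ η} ≤ ε`.  (M11's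
`dominatedStar_timeAverage` with the regime removed; the burn-in logarithm is the volume one of N4.) [ours] -/
theorem dominatedStar_timeAverage_regimeFree [Nontrivial S] (hK : 1 ≤ K) (hm : 1 ≤ m) (ht0 : 0 < t) (ht1 : t < 1)
    (hw0 : ∀ k, 0 ≤ w k) (hw00 : 0 < w 0) (hw1 : ∑ k, w k = 1) (hμ : ∀ k x, 0 < μ k x)
    (hμ1 : ∀ k, ∑ u, μ k u = 1) (hM : ∀ k, IsRowStochastic (M k)) (hMrev : ∀ k, DetailedBalance (μ k) (M k))
    (hM0 : ∀ u v, M 0 u v = μ 0 v) (hp0 : 0 < p) (hp1 : p ≤ 1) (hdom : ∀ r u, p * μ (κ r).succ (φ r u) ≤ μ 0 u)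
    {c : ℕ} (hc1 : 1 ≤ c) (hc : ∀ p' : Fin K, c ≤ (univ.filter (fun r : Fin m => κ r = p')).card)
    {πmin : ℝ} (hmin0 : 0 < πmin) (hmin : ∀ x, πmin ≤ tensorFun μ x)
    (f : (Fin (K + 1) → S) → ℝ) {ε η : ℝ} (hε : 0 < ε) (hη : 0 < η) {r N : ℕ}
    (hr : ⌈1 / (p * min (c * t / (3 * m)) ((1 - t) * w 0 / (7 * K))) * Real.log (1 / (ε * πmin))⌉₊ ≤ r) (hN : 0 < N)
    (hNvar : 4 * lawVariance (tensorFun μ) f / (η ^ 2 * ε) * (1 / (p * min (c * t / (3 * m)) ((1 - t) * w 0 / (7 * K)))) ≤ N)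
    (x : Fin (K + 1) → S) :
    pathSum (fun y z : Fin (K + 1) → S =>
        t * ptGraphSwap μ (fun r : Fin m => (((0 : Fin (K + 1)), (κ r).succ) : Fin (K + 1) × Fin (K + 1))) φ y z
          + (1 - t) * prodKernel w M y z) (N + r) x (fun ω =>
        if η ≤ |(∑ s : Fin N, f ((Matrix.vecCons x ω : Fin (N + r + 1) → (Fin (K + 1) → S))
              ⟨(s : ℕ) + r, by have := s.isLt; omega⟩)) / N - lawMean (tensorFun μ) f|
          then (1 : ℝ) else 0) ≤ ε := by
  have hKr : (1 : ℝ) ≤ K := by exact_mod_cast hK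
  have hmpos : (0 : ℝ) < m := Nat.cast_pos.mpr (by omega)
  have hcpos : (0 : ℝ) < c := Nat.cast_pos.mpr (by omega)
  have h1t : 0 < 1 - t := by linarith
  set G : ℝ := p * min (c * t / (3 * m)) ((1 - t) * w 0 / (7 * K)) with hG
  have hGpos : 0 < G := mul_pos hp0 (lt_min (by positivity) (by positivity))
  have hP := weightedScheme_isRowStochastic (t := t) (w := w)
    (ptGraphSwap_isRowStochastic (e := fun r : Fin m => (((0 : Fin (K + 1)), (κ r).succ) : Fin (K + 1) × Fin (K + 1)))
      (φ := φ) hμ) hM hw0 hw1 ht0.le ht1.le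
  have hDB := weightedScheme_detailedBalance (w := w)
    (ptGraphSwap_detailedBalance (e := fun r : Fin m => (((0 : Fin (K + 1)), (κ r).succ) : Fin (K + 1) × Fin (K + 1)))
      (φ := φ) hμ) hMrev t
  have hirr := dominatedStar_isIrreducible_regimeFree κ φ ht0 ht1 hw0 hw00 hw1 hμ hM hM0 hc1 hc
  have hε2 : 0 < ε / 2 := by linarith
  -- the burn-in: `d(r₀) ≤ ε/2` at `r₀ = ⌈G⁻¹ log(1/(ε π_min))⌉`, hence `t_mix(ε/2) ≤ r₀ ≤ r`
  have hlog : Real.log (1 / (2 * (ε / 2) * πmin)) = Real.log (1 / (ε * πmin)) := by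
    congr 1; ring
  have ht₀ : worstTvDist (fun y z : Fin (K + 1) → S =>
      t * ptGraphSwap μ (fun r : Fin m => (((0 : Fin (K + 1)), (κ r).succ) : Fin (K + 1) × Fin (K + 1))) φ y z
        + (1 - t) * prodKernel w M y z) (tensorFun μ) (⌈1 / G * Real.log (1 / (ε * πmin))⌉₊) ≤ ε / 2 := by
    refine dominatedStar_worstTvDist_le_regimeFree κ φ hK hm ht0 ht1 hw0 hw00 hw1 hμ hμ1 hM hMrev hM0 hp0 hp1 hdom hc1 hc
      hmin0 hmin hε2 ?_
    rw [hlog, ← hG]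
    exact Nat.le_ceil _
  have hmix : mixingTime (fun y z : Fin (K + 1) → S =>
      t * ptGraphSwap μ (fun r : Fin m => (((0 : Fin (K + 1)), (κ r).succ) : Fin (K + 1) × Fin (K + 1))) φ y z
        + (1 - t) * prodKernel w M y z) (tensorFun μ) (ε / 2) ≤ r :=
    (mixingTime_le _ _ ht₀).trans hr
  -- the run length: `4Var/(η²ε)·γ⁻¹ ≤ 4Var/(η²ε)·G⁻¹ ≤ N`
  have hgap := dominatedStar_spectralGap_ge_regimeFree κ φ hK hm ht0 ht1 hw0 hw00 hw1 hμ hμ1 hM hMrev hM0 hp0 hp1 hdom hc1 hc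
  rw [← hG] at hgap
  have hγinv : (spectralGap (tensorFun μ) (fun y z : Fin (K + 1) → S =>
      t * ptGraphSwap μ (fun r : Fin m => (((0 : Fin (K + 1)), (κ r).succ) : Fin (K + 1) × Fin (K + 1))) φ y z
        + (1 - t) * prodKernel w M y z))⁻¹ ≤ 1 / G := by
    rw [← one_div]; exact one_div_le_one_div_of_le hGpos hgap
  have hV : 0 ≤ 4 * lawVariance (tensorFun μ) f / (η ^ 2 * ε) :=
    div_nonneg (mul_nonneg (by norm_num) (lawVariance_nonneg (fun z => (tensorFun_pos hμ z).le) f)) (by positivity)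
  have hNγ : 4 * lawVariance (tensorFun μ) f / (η ^ 2 * ε) * (spectralGap (tensorFun μ)
      (fun y z : Fin (K + 1) → S =>
        t * ptGraphSwap μ (fun r : Fin m => (((0 : Fin (K + 1)), (κ r).succ) : Fin (K + 1) × Fin (K + 1))) φ y z
          + (1 - t) * prodKernel w M y z))⁻¹ ≤ N := by
    exact (mul_le_mul_of_nonneg_left hγinv hV).trans hNvar
  exact LevinPeres2017_thm_12_21 (fun z => tensorFun_pos hμ z) (sum_tensorFun_eq_one _ hμ1) hP hDB hirr f hε hη ht₀
    hmix hN hNγ x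

end Avg

end Summit.Ventures.LatticeQCDFlow.Scaling

end
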